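import Summits.CriticalPhenomena.PercolationContinuityZ3.Theorems.PercNearOneGluingNoHeavyQuantAtMostOneBound
import Summits.CriticalPhenomena.PercolationContinuityZ3.Theorems.PercNearOneGluingNoHeavyQuantIndepBlobThreeBlobs
import HarnessLib

/-!
# QUANT lane R8, Conjecture DIB\* — **KERNEL ON THE PAIRWISE-COMPLETING CLASS, ANY NUMBER OF BLOBS, EVERY FLOOR `1/2 ≤ x < 1`**:
# `P(at least two of n independent events) ≥ x` whenever their credit rates sum to `≥ 2`

builds on p205010 (kernel theorem, internal audit signed; external expert review pending)

Support file (`--supports stmt-CriticalPhenomena-4575`), QUANT lane typer seat prim-quant-stmt (gen 20), rung R8 of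
`run/shared/lean/prim/quant/LADDER.md`.  Theorems only.  Parts A–C: `…QuantAtMostOne` (the `AMO` calculus and the pair-completion TERM rule
`term_ge_one_sub_amo`), `…QuantAtMostOneAnalytic` (chord/endpoint lemmas, `B'_n(y) ≤ 1`), `…QuantAtMostOneBound` (`amo_le_of_four_le_card`);
the three-blob case is `…QuantIndepBlobThreeBlobs` (`two_of_three_ge_floor`, Handelman certificates).

Conjecture DIB\* (`Quant.IndepBlob.DIBStar x`): independent blobs, sizes `a k`, gates `g k ∈ [0,1]`, floor `x`, layer `j`, light blobs (`g k < x`) of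
size `≤ j`, credit rates `φ_x(g) = g` (heavy) / `κ_x(g) = (g − x²)/(1 − x)` (light), `Σ a k·φ_x(g k) > 2j` ⟹ `x ≤ P(N ≥ j+1)`.  THE PAIRWISE-COMPLETING
CLASS: every two non-empty blobs together reach the target (`j + 1 ≤ a k + a l`).  There `N ≥ j+1` iff at least two non-empty blobs are open (no
giants) and the credit forces `Σ φ_x > 2` over the non-empty blobs of positive rate, so DIB\* reduces to the abstract inequality below — which is
DIB\* for UNIT blobs at layer `1`, with ARBITRARILY MANY LIGHT BLOBS (the lane's first such kernel family; it contains the lead's S7/9 extremal family,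
every system of `≤ 3` blobs, and all systems of blobs tied at a size `≥ (j+1)/2`).

* `Quant.IndepBlob.one_sub_le_pseudo` — the pseudo-blob relaxation `1 − g ≤ (1 − x)(2 − (1 − x) − φ_x(g))`.
* `Quant.IndepBlob.amo_pair_eq_zero`, `amo_triple` — `AMO` of two sure blobs / of three blobs in closed form.
* **`Quant.IndepBlob.amo_le_of_credit` — AT LEAST TWO OF `n`**: `1/2 ≤ x < 1`, events `k ∈ T` of probabilities `g k ∈ [0,1]` with
  `Σ_T φ_x(g k) ≥ 2` ⟹ `AMO[T, 1 − g] ≤ 1 − x`, i.e. `P(at least two occur) ≥ x` (nonpositive rates discarded by `amo_le_of_subset`; two blobs ⟹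
  both sure; three ⟹ `two_of_three_ge_floor`; four or more ⟹ `amo_le_of_four_le_card`).
* **`Quant.RootDec.term_ge_of_pairCompleting` — THE PAIR-COMPLETION CERTIFICATE (TERM rule)**: gates in `[0,1]`; any finset `T` of blobs pairwise
  completing at the sure part `s` with rates summing to `≥ 2` ⟹ `x ≤ TERM[s, a, g, j]`, other blobs arbitrary (generalises `term_ge_of_triple`).
* **`Quant.IndepBlob.tail_ge_of_pairCompleting` — DIB\* FOR EVERY SYSTEM WHOSE NON-EMPTY BLOBS PAIRWISE COMPLETE**, every floor `1/2 ≤ x < 1`, in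
  `DIBWith`'s binder shape plus `∀ k ≠ l, 0 < a k → 0 < a l → j + 1 ≤ a k + a l`.

NOVELTY.  presearch (2026-08-21): "lower bound for the probability that at least two of n independent events occur in terms of a budget on the
marginals / Poisson-binomial P(X ≤ 1)" → Hoeffding (1956, Ann. Math. Statist. 27, Thm 4: binomial comparison at fixed mean — ignores the floor and
fails here for `x > 0.6`), Bonferroni/S₂–S₃ textbook pages; nothing with a floor-dependent discount (corpus hybrid + vsearch + galaxy, see
`…QuantIndepBlobThreeBlobs`).  The pseudo-blob relaxation + AM–GM + chord route is [this work]; numerics kit j130470 (exact: `b_5 = 1009/1024`,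
`max B'_4 = 0.7717`; random/tight sampling of the inequality for `n = 4..8`: normalised margin `≥ 0.38`).  BARRIERS: none of
`Literature/Barriers/CriticalPhenomena/…` concern finite product-measure rows.  [this work]; the gluing rows served
[cite: KozmaNitzan2024, Conjecture 3 (p. 15)]; product weights [cite: Grimmett1999, §1.3 p. 10].
-/

namespace Summit.CriticalPhenomena.PercolationContinuityZ3.Theorems

namespace Quant

namespace IndepBlob

open Finset

section Credit

variable {κ : Type} [DecidableEq κ]

/-- probability that at most one blob of `T` is open, closure probabilities `q` (as in `…QuantAtMostOne`) -/
local notation3 "AMO[" T ", " q "]" =>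
  (∏ k ∈ (T : Finset κ), (q : κ → ℝ) k) + ∑ k ∈ (T : Finset κ), (1 - (q : κ → ℝ) k) * ∏ l ∈ (T : Finset κ).erase k, (q : κ → ℝ) l

/-! ### 1. From credit rates to the relaxed data -/

/-- **The pseudo-blob relaxation**: for `1/2 ≤ x < 1` and a gate `g ≤ 1` with credit rate `φ = g` (`x ≤ g`) or `(g − x²)/(1 − x)` (`g < x`):
`1 − g ≤ (1 − x)·(2 − (1 − x) − φ)` (equality for a light blob; for a heavy one the slack is `x (g − x)`). [this work] -/
theorem one_sub_le_pseudo (x g : ℝ) (hx : 0 ≤ x) (hx1 : x < 1) :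
    1 - g ≤ (1 - x) * (2 - (1 - x) - (if x ≤ g then g else (g - x ^ 2) / (1 - x))) := by
  by_cases h : x ≤ g
  · rw [if_pos h]; nlinarith [mul_nonneg hx (sub_nonneg.2 h)]
  · rw [if_neg h]
    have h1x : (0 : ℝ) < 1 - x := by linarith
    have e : (1 - x) * (2 - (1 - x) - (g - x ^ 2) / (1 - x)) = 1 - g := by field_simp; ring
    rw [e]

/-- `AMO` of two SURE blobs vanishes: `q k₁ = q k₂ = 0`, `k₁ ≠ k₂` ⟹ `AMO[{k₁, k₂}, q] = 0`. [this work] -/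
theorem amo_pair_eq_zero (q : κ → ℝ) (k₁ k₂ : κ) (hne : k₁ ≠ k₂) (h₁ : q k₁ = 0) (h₂ : q k₂ = 0) :
    AMO[({k₁, k₂} : Finset κ), q] = 0 := by
  rw [amo_insert {k₂} q k₁ (by simpa using hne)]
  simp [h₁, h₂]

/-- `AMO` of three blobs in closed form. [this work] -/
theorem amo_triple (q : κ → ℝ) (k₁ k₂ k₃ : κ) (h12 : k₁ ≠ k₂) (h13 : k₁ ≠ k₃) (h23 : k₂ ≠ k₃) :
    AMO[({k₁, k₂, k₃} : Finset κ), q] =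
      q k₁ * (q k₂ * 1 + (1 - q k₂) * q k₃) + (1 - q k₁) * (q k₂ * q k₃) := by
  rw [amo_insert {k₂, k₃} q k₁ (by simp [h12, h13]), amo_insert {k₃} q k₂ (by simpa using h23)]
  simp [Finset.prod_pair h23]

/-! ### 2. THE MAIN INEQUALITY: at least two open -/

/-- **AT LEAST TWO OF `n` — Conjecture DIB\* for unit blobs at layer one, every floor `1/2 ≤ x < 1`.**  For independent events `k ∈ T` with
probabilities `g k ∈ [0,1]` and credit rates `φ_x(g) = g` (`x ≤ g`) or `κ_x(g) = (g − x²)/(1 − x)` (`g < x`): if `Σ_{k∈T} φ_x(g k) ≥ 2` then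
`P(at most one of them occurs) = AMO[T, 1 − g] ≤ 1 − x`, i.e. **`P(at least two occur) ≥ x`**.  (Blobs of nonpositive credit are discarded
(`amo_le_of_subset`); two blobs force two sure blobs; three blobs are `two_of_three_ge_floor` (Handelman certificates); four or more blobs are
`amo_le_of_four_le_card`.) [this work] -/
theorem amo_le_of_credit (x : ℝ) (hx : 1 / 2 ≤ x) (hx1 : x < 1) (T : Finset κ) (g : κ → ℝ)
    (hg : ∀ k ∈ T, 0 ≤ g k ∧ g k ≤ 1)
    (hcr : 2 ≤ ∑ k ∈ T, (if x ≤ g k then g k else (g k - x ^ 2) / (1 - x))) :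
    AMO[T, fun k => 1 - g k] ≤ 1 - x := by
  set φ : κ → ℝ := fun k => if x ≤ g k then g k else (g k - x ^ 2) / (1 - x) with hφ
  set T' := T.filter (fun k => 0 < φ k) with hT'
  have hsub : T' ⊆ T := Finset.filter_subset _ _
  have hcr' : 2 ≤ ∑ k ∈ T', φ k := by
    have hsplit := Finset.sum_filter_add_sum_filter_not T (fun k => 0 < φ k) φ
    have hneg : ∑ k ∈ T.filter (fun k => ¬ 0 < φ k), φ k ≤ 0 :=
      Finset.sum_nonpos fun k hk => not_lt.1 (Finset.mem_filter.1 hk).2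
    have hcrT : 2 ≤ ∑ k ∈ T, φ k := hcr
    linarith
  have hpos : ∀ k ∈ T', 0 < φ k := fun k hk => (Finset.mem_filter.1 hk).2
  have hq : ∀ k ∈ T, 0 ≤ 1 - g k ∧ 1 - g k ≤ 1 := fun k hk => ⟨by linarith [(hg k hk).2], by linarith [(hg k hk).1]⟩
  refine (amo_le_of_subset T' T hsub (fun k => 1 - g k) hq).trans ?_
  have hφ1 : ∀ k ∈ T, φ k ≤ 1 := fun k hk => creditRate_le_one x (g k) hx1 (hg k hk).2
  rcases Nat.lt_or_ge T'.card 4 with hlt | hge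
  · rcases Nat.lt_or_ge T'.card 3 with hlt3 | hge3
    · -- at most two positive-credit blobs: then exactly two, both sure
      have hall : ∀ k ∈ T', φ k = 1 := by
        intro k hk
        by_contra hne
        have hlt1 : φ k < 1 := lt_of_le_of_ne (hφ1 k (hsub hk)) hne
        have h1 : ∑ l ∈ T'.erase k, φ l ≤ (T'.erase k).card • (1 : ℝ) :=
          Finset.sum_le_card_nsmul _ _ _ fun l hl => hφ1 l (hsub (Finset.mem_of_mem_erase hl))
        rw [nsmul_eq_mul, mul_one, Finset.card_erase_of_mem hk] at h1
        have h2 := Finset.add_sum_erase T' φ hk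
        have h3 : ((T'.card - 1 : ℕ) : ℝ) ≤ 1 := by exact_mod_cast (by omega : T'.card - 1 ≤ 1)
        linarith
      have hg1 : ∀ k ∈ T', g k = 1 := by
        intro k hk
        have h := hall k hk
        by_cases hxg : x ≤ g k
        · have : φ k = g k := by simp only [hφ]; rw [if_pos hxg]
          linarith
        · exfalso
          have : φ k = (g k - x ^ 2) / (1 - x) := by simp only [hφ]; rw [if_neg hxg]
          rw [this, div_eq_one_iff_eq (by linarith : (1 : ℝ) - x ≠ 0)] at h
          nlinarith [not_le.1 hxg]
      have hcard2 : 1 < T'.card := by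
        by_contra h
        push Not at h
        have hb : ∑ k ∈ T', φ k ≤ T'.card • (1 : ℝ) := Finset.sum_le_card_nsmul _ _ _ fun k hk => hφ1 k (hsub hk)
        rw [nsmul_eq_mul, mul_one] at hb
        have : (T'.card : ℝ) ≤ 1 := by exact_mod_cast h
        linarith
      obtain ⟨k₁, hk₁, k₂, hk₂, hne⟩ := Finset.one_lt_card.1 hcard2
      have hpair : ({k₁, k₂} : Finset κ) ⊆ T' := by
        intro k hk
        rcases Finset.mem_insert.1 hk with rfl | hk
        · exact hk₁
        · rw [Finset.mem_singleton.1 hk]; exact hk₂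
      refine (amo_le_of_subset {k₁, k₂} T' hpair (fun k => 1 - g k) fun k hk => hq k (hsub hk)).trans ?_
      rw [amo_pair_eq_zero (fun k => 1 - g k) k₁ k₂ hne (by simp [hg1 k₁ hk₁]) (by simp [hg1 k₂ hk₂])]
      linarith
    · -- exactly three
      obtain ⟨k₁, k₂, k₃, h12, h13, h23, hT3⟩ := Finset.card_eq_three.1 (by omega : T'.card = 3)
      have hsum3 : ∑ k ∈ T', φ k = φ k₁ + (φ k₂ + φ k₃) := by
        rw [hT3, Finset.sum_insert (by simp [h12, h13]), Finset.sum_insert (by simp [h23]), Finset.sum_singleton]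
      have hk₁ : k₁ ∈ T := hsub (hT3 ▸ by simp)
      have hk₂ : k₂ ∈ T := hsub (hT3 ▸ by simp)
      have hk₃ : k₃ ∈ T := hsub (hT3 ▸ by simp)
      have two := two_of_three_ge_floor x (g k₁) (g k₂) (g k₃) hx hx1 (hg k₁ hk₁) (hg k₂ hk₂) (hg k₃ hk₃)
        (by rw [hsum3] at hcr'; simp only [hφ] at hcr'; linarith)
      rw [hT3, amo_triple (fun k => 1 - g k) k₁ k₂ k₃ h12 h13 h23]
      nlinarith [two]
  · -- four or more
    exact amo_le_of_four_le_card T' hge (1 - x) (by linarith) (by linarith) (fun k => 1 - g k) φ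
      (fun k hk => ⟨(hpos k hk).le, hφ1 k (hsub hk)⟩)
      (fun k hk => ⟨(hq k (hsub hk)).1, one_sub_le_pseudo x (g k) (by linarith) hx1⟩) hcr'

end Credit

end IndepBlob

namespace RootDec

open Finset

variable {κ : Type} [Fintype κ] [DecidableEq κ]

/-- product-Bernoulli weight of the set `W` of open blobs (as in `…QuantRootReduction`) -/
local notation3 "wt[" g ", " W "]" => ∏ k, (if k ∈ (W : Finset κ) then (g : κ → ℝ) k else 1 - (g : κ → ℝ) k)

/-- the TERM tail `P(s + Σ_{k open} a k ≥ j+1)` (as in `…QuantRootReduction`) -/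
local notation3 "TERM[" s ", " a ", " g ", " j "]" =>
  ∑ W : Finset κ, wt[g, W] * (if (j : ℕ) + 1 ≤ (s : ℕ) + ∑ k ∈ W, (a : κ → ℕ) k then (1 : ℝ) else 0)

/-! ### 3. The TERM rule and DIB\* on the pairwise-completing class -/

/-- **THE PAIR-COMPLETION CERTIFICATE (TERM rule).**  Gates in `[0,1]`, `1/2 ≤ x < 1`; a finset `T` of blobs, any two of which complete at the
sure part `s`, whose credit rates sum to `≥ 2` ⟹ `x ≤ TERM[s, a, g, j]` — whatever the other blobs (generalises the triple certificate
`term_ge_of_triple` to any number of blobs). [this work] -/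
theorem term_ge_of_pairCompleting (s : ℕ) (a : κ → ℕ) (g : κ → ℝ) (j : ℕ) (hg : ∀ k, 0 ≤ g k ∧ g k ≤ 1) (T : Finset κ)
    (hpair : ∀ k ∈ T, ∀ l ∈ T, k ≠ l → j + 1 ≤ s + a k + a l) (x : ℝ) (hx : 1 / 2 ≤ x) (hx1 : x < 1)
    (hcr : 2 ≤ ∑ k ∈ T, (if x ≤ g k then g k else (g k - x ^ 2) / (1 - x))) : x ≤ TERM[s, a, g, j] := by
  have h1 := term_ge_one_sub_amo g j hg T s a hpair
  have h2 := IndepBlob.amo_le_of_credit x hx hx1 T g (fun k _ => hg k) hcr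
  linarith

end RootDec

namespace IndepBlob

open Finset

/-- **DIB\* ON THE PAIRWISE-COMPLETING CLASS, every floor `1/2 ≤ x < 1`, ANY NUMBER OF BLOBS.**  Gates in `[0,1]`, light blobs (`g k < x`) of size
`≤ j`, EVERY TWO NON-EMPTY BLOBS COMPLETE (`j + 1 ≤ a k + a l`), credit `Σ a k·φ_x(g k) > 2j` ⟹ `x ≤ P(N ≥ j+1)`.  (A heavy giant decides alone;
otherwise all sizes are `≤ j`, so the non-empty blobs of positive rate have rates summing to `> 2`, and `term_ge_of_pairCompleting` applies.)  The class
contains every system of at most three blobs (`…QuantIndepBlobThreeBlobs`) and all systems of blobs tied at a size `≥ (j+1)/2` — in particular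
arbitrarily many LIGHT blobs. [this work] -/
theorem tail_ge_of_pairCompleting (x : ℝ) (hx : 1 / 2 ≤ x) (hx1 : x < 1) {ι : Type} [Fintype ι] [DecidableEq ι]
    (a : ι → ℕ) (g : ι → ℝ) (j : ℕ) (hg : ∀ k, 0 ≤ g k ∧ g k ≤ 1) (hlight : ∀ k, g k < x → a k ≤ j)
    (hpair : ∀ k l, k ≠ l → 0 < a k → 0 < a l → j + 1 ≤ a k + a l)
    (hcredit : (2 * j : ℝ) < ∑ k, (a k : ℝ) * (if x ≤ g k then g k else (g k - x ^ 2) / (1 - x))) :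
    x ≤ ∑ W : Finset ι, (∏ k, if k ∈ W then g k else 1 - g k) * (if j + 1 ≤ ∑ k ∈ W, a k then (1 : ℝ) else 0) := by
  have hT : (∑ W : Finset ι, (∏ k, if k ∈ W then g k else 1 - g k) * (if j + 1 ≤ 0 + ∑ k ∈ W, a k then (1 : ℝ) else 0)) =
      ∑ W : Finset ι, (∏ k, if k ∈ W then g k else 1 - g k) * (if j + 1 ≤ ∑ k ∈ W, a k then (1 : ℝ) else 0) :=
    Finset.sum_congr rfl fun W _ => by rw [zero_add]
  by_cases hgiant : ∃ k, x ≤ g k ∧ j + 1 ≤ a k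
  · obtain ⟨k, hxk, hk⟩ := hgiant
    have h := RootDec.gate_le_term_of_giant 0 a g j hg k (by omega)
    rw [hT] at h
    exact hxk.trans h
  push Not at hgiant
  have hsize : ∀ k, a k ≤ j := fun k => by
    by_cases h : g k < x
    · exact hlight k h
    · exact Nat.lt_succ_iff.1 (hgiant k (not_lt.1 h))
  set φ : ι → ℝ := fun k => if x ≤ g k then g k else (g k - x ^ 2) / (1 - x) with hφ
  set T := Finset.univ.filter (fun k => 0 < a k ∧ 0 < φ k) with hTdef
  -- the credit lives on `T`, where `a ≤ j`
  have hsplit := Finset.sum_filter_add_sum_filter_not (Finset.univ : Finset ι) (fun k => 0 < a k ∧ 0 < φ k)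
    (fun k => (a k : ℝ) * φ k)
  have hrest : ∑ k ∈ Finset.univ.filter (fun k => ¬ (0 < a k ∧ 0 < φ k)), (a k : ℝ) * φ k ≤ 0 := by
    refine Finset.sum_nonpos fun k hk => ?_
    have h := (Finset.mem_filter.1 hk).2
    by_cases ha : 0 < a k
    · have hφk : φ k ≤ 0 := not_lt.1 fun h' => h ⟨ha, h'⟩
      exact mul_nonpos_iff.2 (Or.inl ⟨Nat.cast_nonneg _, hφk⟩)
    · have : a k = 0 := by omega
      rw [this, Nat.cast_zero, zero_mul]
  have hTj : ∑ k ∈ T, (a k : ℝ) * φ k ≤ (j : ℝ) * ∑ k ∈ T, φ k := by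
    rw [Finset.mul_sum]
    refine Finset.sum_le_sum fun k hk => ?_
    have hk' := (Finset.mem_filter.1 hk).2
    exact mul_le_mul_of_nonneg_right (by exact_mod_cast hsize k) hk'.2.le
  have hcrT : (j : ℝ) * 2 < (j : ℝ) * ∑ k ∈ T, φ k := by linarith
  have hcr : 2 ≤ ∑ k ∈ T, φ k := (lt_of_mul_lt_mul_left hcrT (Nat.cast_nonneg j)).le
  have key := RootDec.term_ge_of_pairCompleting 0 a g j hg T (fun k hk l hl hkl => by
    have := hpair k l hkl (Finset.mem_filter.1 hk).2.1 (Finset.mem_filter.1 hl).2.1; omega) x hx hx1 hcr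
  rw [hT] at key
  exact key

/-- **DIB\* for TIED blobs, any number of them**: every non-empty blob has the same size `s` with `2s ≥ j + 1` (so any two complete); gates in
`[0,1]`, light blobs of size `≤ j`, credit `> 2j`, `1/2 ≤ x < 1` ⟹ `x ≤ P(N ≥ j+1)`.  (The lead's S7/9 family is three tied blobs of size `j`.) [this work] -/
theorem tail_ge_of_tied (x : ℝ) (hx : 1 / 2 ≤ x) (hx1 : x < 1) {ι : Type} [Fintype ι] [DecidableEq ι]
    (a : ι → ℕ) (g : ι → ℝ) (j s : ℕ) (hs : j + 1 ≤ 2 * s) (htied : ∀ k, a k = 0 ∨ a k = s)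
    (hg : ∀ k, 0 ≤ g k ∧ g k ≤ 1) (hlight : ∀ k, g k < x → a k ≤ j)
    (hcredit : (2 * j : ℝ) < ∑ k, (a k : ℝ) * (if x ≤ g k then g k else (g k - x ^ 2) / (1 - x))) :
    x ≤ ∑ W : Finset ι, (∏ k, if k ∈ W then g k else 1 - g k) * (if j + 1 ≤ ∑ k ∈ W, a k then (1 : ℝ) else 0) := by
  refine tail_ge_of_pairCompleting x hx hx1 a g j hg hlight (fun k l _ hk hl => ?_) hcredit
  rcases htied k with h | h
  · omega
  · rcases htied l with h' | h'
    · omega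
    · omega

end IndepBlob


end Quant

end Summit.CriticalPhenomena.PercolationContinuityZ3.Theorems
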